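import Mathlib
import Literature.Analysis.SpecialFunctions.FactorialRootLimit

/-!
# `DivisionGap.PerMultiplesHard` (stmt-ValiantsHypothesis-5068), line `uncharged-face-walk`:
stub `stub_smallWindowArith` — the arithmetic of the small-window jaw

Inputs: a board size `a`, a degree `f` with `f ≤ a ≤ C f`, a window `k` with `a < D k ≤ 2a`
where `D = 1024 C`, a column count `u` with `k ≤ 2u ≤ 4k`, `u ≤ a`, a circuit size `L`, and the
raw counting inequality

  `f^a · a! ≤ L · a^a · C(2k,u) · u! · ((f!)^{1/f})^{a−u}`.

Output: `16^k ≤ L² · e^{2(C+1)} · a^{C+1}`.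

Proof (in logarithms).  `L ≥ 1`, `C ≥ 1`, `k, u ≥ 1` and `f ≥ 512 k`.  With
`log a! ≥ a log a − a` (from `a^a / a! ≤ e^a`, Mathlib `Real.pow_div_factorial_le_exp`),
`log u! ≤ u log u − u + (log u)/2 + 1`, `log f! ≤ f log f − f + (log f)/2 + 1` (the tree's
`Literature.Analysis.SpecialFunctions.log_factorial_le`) and `C(2k,u) ≤ 4^k`
(`Nat.choose_le_two_pow`), the terms `a log f`, `a log a`, `a` cancel and leave
`u (log f − log u) ≤ log L + 2k log 2 + (C+1)((log a)/2 + 1)`; on the other side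
`u (log f − log u) ≥ (k/2) · log 256 = 4k log 2` because `u ≥ k/2`, `u ≤ 2k` and `f ≥ 512 k`.
Hence `4k log 2 ≤ 2 log L + 2(C+1) + (C+1) log a`, which is the claim after exponentiating.
-/

noncomputable section

set_option linter.dupNamespace false

namespace Summit.ValiantsHypothesis.ValiantsHypothesis.Theorems.DivisionGap.PerMultiplesHard.SmallWindowArith

/-- **Stirling from below, crude form.**  For every natural `a`, `a log a − a ≤ log a!`, i.e.
`a^a ≤ e^a · a!`, which is the single term `a^a / a! ≤ e^a` of the exponential series
(`Real.pow_div_factorial_le_exp`). [folklore] -/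
theorem log_factorial_ge (a : ℕ) :
    (a : ℝ) * Real.log (a : ℝ) - a ≤ Real.log (a.factorial : ℝ) := by
  have hfpos : (0 : ℝ) < (a.factorial : ℝ) := by exact_mod_cast a.factorial_pos
  rcases Nat.eq_zero_or_pos a with h0 | hpos
  · subst h0
    simp
  have hapos : (0 : ℝ) < (a : ℝ) := by exact_mod_cast hpos
  have h := Real.pow_div_factorial_le_exp (a : ℝ) (Nat.cast_nonneg a) a
  rw [div_le_iff₀ hfpos] at h
  have hpow : (0 : ℝ) < (a : ℝ) ^ a := pow_pos hapos a
  have hlog := Real.log_le_log hpow h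
  rw [Real.log_pow, Real.log_mul (Real.exp_pos _).ne' hfpos.ne', Real.log_exp] at hlog
  linarith

/-- **stub_smallWindowArith — the arithmetic of the small-window jaw.**  From the raw counting
inequality `f^a · a! ≤ L · a^a · C(2k,u) · u! · ((f!)^{1/f})^{a−u}` on an `a`-board with
`f ≤ a ≤ C f`, window `a < D k ≤ 2a` for `D = 1024 C` and `k ≤ 2u ≤ 4k`, `u ≤ a`:
`16^k ≤ L² · e^{2(C+1)} · a^{C+1}`.  Proof in logarithms: `log a! ≥ a log a − a`
(`log_factorial_ge`), `log u! ≤ u log u − u + ½ log u + 1` and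
`(log f!)/f ≤ log f − 1 + (½ log f + 1)/f` (`Literature.Analysis.SpecialFunctions.log_factorial_le`),
`C(2k,u) ≤ 4^k`; the terms `a log a`, `a log f`, `a` cancel and leave
`u log(f/u) ≤ log L + 2k log 2 + (C+1)(½ log a + 1)`; finally
`u log(f/u) ≥ (k/2) log(f/(2k)) ≥ 4k log 2` because `f ≥ 512k`. [folklore] -/
theorem stub_smallWindowArith :
    ∀ (a f k u L C D : ℕ), 1 ≤ a → 1 ≤ f → f ≤ a → a ≤ C * f → D = 1024 * C →
      a < D * k → D * k ≤ 2 * a → k ≤ 2 * u → u ≤ 2 * k → u ≤ a →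
      (f : ℝ) ^ a * (a.factorial : ℝ) ≤
        (L : ℝ) * (a : ℝ) ^ a * ((2 * k).choose u : ℝ) * (u.factorial : ℝ) *
          ((((f.factorial : ℕ) : ℝ) ^ ((1 : ℝ) / (f : ℝ))) ^ (a - u)) →
      (16 : ℝ) ^ k ≤ (L : ℝ) ^ 2 * Real.exp (2 * ((C : ℝ) + 1)) * (a : ℝ) ^ (C + 1) := by
  intro a f k u L C D ha hf hfa haC hD haDk hDk hku huk hua hmain
  subst hD
  -- ℕ bookkeeping: `C ≥ 1`, `k ≥ 1`, `u ≥ 1`, `f ≥ 512 k`, `L ≥ 1`.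
  have hC : 1 ≤ C := by
    rcases Nat.eq_zero_or_pos C with h | h
    · subst h
      omega
    · exact h
  have hk : 1 ≤ k := by
    rcases Nat.eq_zero_or_pos k with h | h
    · subst h
      omega
    · exact h
  have hu : 1 ≤ u := by omega
  have hfk : 512 * k ≤ f := by
    have h1 : 1024 * C * k ≤ 2 * (C * f) := le_trans hDk (by omega)
    have h2 : C * (512 * k) ≤ C * f := by
      have : 1024 * C * k = 2 * (C * (512 * k)) := by ring
      omega
    exact Nat.le_of_mul_le_mul_left h2 (by omega)
  have hL : 1 ≤ L := by
    by_contra hcon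
    have hL0 : L = 0 := by omega
    subst hL0
    have hpos : (0 : ℝ) < (f : ℝ) ^ a * (a.factorial : ℝ) := by positivity
    simp only [Nat.cast_zero, zero_mul] at hmain
    linarith
  -- Real casts.
  have har : (1 : ℝ) ≤ a := by exact_mod_cast ha
  have hfr : (1 : ℝ) ≤ f := by exact_mod_cast hf
  have hur : (1 : ℝ) ≤ u := by exact_mod_cast hu
  have hLr : (1 : ℝ) ≤ L := by exact_mod_cast hL
  have hCr : (1 : ℝ) ≤ C := by exact_mod_cast hC
  have hfar : (f : ℝ) ≤ a := by exact_mod_cast hfa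
  have huar : (u : ℝ) ≤ a := by exact_mod_cast hua
  have haCr : (a : ℝ) ≤ C * f := by exact_mod_cast haC
  have hfkr : 512 * (k : ℝ) ≤ f := by exact_mod_cast hfk
  have hkur : (k : ℝ) ≤ 2 * u := by exact_mod_cast hku
  have hukr : (u : ℝ) ≤ 2 * k := by exact_mod_cast huk
  have hsub : ((a - u : ℕ) : ℝ) = (a : ℝ) - u := Nat.cast_sub hua
  have hapos : (0 : ℝ) < a := by linarith
  have hfpos : (0 : ℝ) < f := by linarith
  have hupos : (0 : ℝ) < u := by linarith
  have hLpos : (0 : ℝ) < L := by linarith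
  have hk0 : (0 : ℝ) ≤ k := Nat.cast_nonneg k
  have hfa_pos : (0 : ℝ) < (a.factorial : ℝ) := by exact_mod_cast a.factorial_pos
  have hfu_pos : (0 : ℝ) < (u.factorial : ℝ) := by exact_mod_cast u.factorial_pos
  have hff_pos : (0 : ℝ) < ((f.factorial : ℕ) : ℝ) := by exact_mod_cast f.factorial_pos
  have hch_pos : (0 : ℝ) < ((2 * k).choose u : ℝ) := by exact_mod_cast Nat.choose_pos huk
  set R : ℝ := ((f.factorial : ℕ) : ℝ) ^ ((1 : ℝ) / (f : ℝ)) with hR_def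
  have hR_pos : 0 < R := Real.rpow_pos_of_pos hff_pos _
  have hlogR : Real.log R = (1 / (f : ℝ)) * Real.log ((f.factorial : ℕ) : ℝ) := by
    rw [hR_def, Real.log_rpow hff_pos]
  -- Logarithms of the four sizes.
  set la : ℝ := Real.log (a : ℝ) with hla
  set lf : ℝ := Real.log (f : ℝ) with hlf
  set lu : ℝ := Real.log (u : ℝ) with hlu
  set X : ℝ := Real.log (L : ℝ) with hX
  have hlf0 : 0 ≤ lf := Real.log_nonneg hfr
  have hlu0 : 0 ≤ lu := Real.log_nonneg hur
  have hlfa : lf ≤ la := Real.log_le_log hfpos hfar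
  have hlua : lu ≤ la := Real.log_le_log hupos huar
  have hlog2 : 0 < Real.log 2 := Real.log_pos (by norm_num)
  -- (B0) `log f − log u ≥ log 256 = 8 log 2` (`256 u ≤ 512 k ≤ f`).
  have hfu : 8 * Real.log 2 ≤ lf - lu := by
    have hu256 : (256 : ℝ) * u ≤ f := by linarith
    have h1 : Real.log (256 * u) ≤ lf := Real.log_le_log (by positivity) hu256
    rw [Real.log_mul (by norm_num) hupos.ne', show (256 : ℝ) = 2 ^ 8 by norm_num,
      Real.log_pow] at h1
    push_cast at h1
    linarith
  -- (B1) Stirling from below.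
  have hB1 : (a : ℝ) * la - a ≤ Real.log (a.factorial : ℝ) := log_factorial_ge a
  -- (B2) Stirling from above (the tree lemma), for `u` and for `f`.
  have hB2u : Real.log (u.factorial : ℝ) ≤ u * lu - u + lu / 2 + 1 :=
    Literature.Analysis.SpecialFunctions.log_factorial_le (by omega)
  have hB2f : Real.log ((f.factorial : ℕ) : ℝ) ≤ f * lf - f + lf / 2 + 1 :=
    Literature.Analysis.SpecialFunctions.log_factorial_le (by omega)
  -- (B3) `C(2k,u) ≤ 2^(2k)`.
  have hB3 : Real.log ((2 * k).choose u : ℝ) ≤ 2 * k * Real.log 2 := by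
    have h1 : ((2 * k).choose u : ℝ) ≤ (2 : ℝ) ^ (2 * k) := by
      exact_mod_cast Nat.choose_le_two_pow (2 * k) u
    have h2 := Real.log_le_log hch_pos h1
    rw [Real.log_pow] at h2
    push_cast at h2
    linarith
  -- Take logarithms of the counting inequality.
  have hlhs_pos : (0 : ℝ) < (f : ℝ) ^ a * (a.factorial : ℝ) := by positivity
  have hlog := Real.log_le_log hlhs_pos hmain
  have hlhs : Real.log ((f : ℝ) ^ a * (a.factorial : ℝ)) =
      a * lf + Real.log (a.factorial : ℝ) := by
    rw [Real.log_mul (pow_pos hfpos a).ne' hfa_pos.ne', Real.log_pow]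
  have hn1 : (L : ℝ) * (a : ℝ) ^ a ≠ 0 := (mul_pos hLpos (pow_pos hapos a)).ne'
  have hn2 : (L : ℝ) * (a : ℝ) ^ a * ((2 * k).choose u : ℝ) ≠ 0 :=
    (mul_pos (mul_pos hLpos (pow_pos hapos a)) hch_pos).ne'
  have hn3 : (L : ℝ) * (a : ℝ) ^ a * ((2 * k).choose u : ℝ) * (u.factorial : ℝ) ≠ 0 :=
    (mul_pos (mul_pos (mul_pos hLpos (pow_pos hapos a)) hch_pos) hfu_pos).ne'
  have hrhs : Real.log ((L : ℝ) * (a : ℝ) ^ a * ((2 * k).choose u : ℝ) * (u.factorial : ℝ) *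
      R ^ (a - u)) = X + a * la + Real.log ((2 * k).choose u : ℝ) +
        Real.log (u.factorial : ℝ) +
        ((a : ℝ) - u) * ((1 / (f : ℝ)) * Real.log ((f.factorial : ℕ) : ℝ)) := by
    rw [Real.log_mul hn3 (pow_pos hR_pos _).ne', Real.log_mul hn2 hfu_pos.ne',
      Real.log_mul hn1 hch_pos.ne', Real.log_mul hLpos.ne' (pow_pos hapos a).ne',
      Real.log_pow, Real.log_pow, hlogR, hsub]
  rw [hlhs, hrhs] at hlog
  -- The rpow factor: `(a − u) (log f!)/f ≤ (a − u)(log f − 1) + C ((log f)/2 + 1)`.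
  have hlast : ((a : ℝ) - u) * ((1 / (f : ℝ)) * Real.log ((f.factorial : ℕ) : ℝ)) ≤
      ((a : ℝ) - u) * (lf - 1) + C * (lf / 2 + 1) := by
    have hau : 0 ≤ (a : ℝ) - u := by linarith
    have h1 : ((a : ℝ) - u) * ((1 / (f : ℝ)) * Real.log ((f.factorial : ℕ) : ℝ)) ≤
        ((a : ℝ) - u) * ((1 / (f : ℝ)) * (f * lf - f + lf / 2 + 1)) := by
      apply mul_le_mul_of_nonneg_left _ hau
      exact mul_le_mul_of_nonneg_left hB2f (by positivity)
    have h2 : ((a : ℝ) - u) * ((1 / (f : ℝ)) * (f * lf - f + lf / 2 + 1)) =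
        ((a : ℝ) - u) * (lf - 1) + ((a : ℝ) - u) / f * (lf / 2 + 1) := by
      field_simp
      ring
    have h3 : ((a : ℝ) - u) / f ≤ C := by
      rw [div_le_iff₀ hfpos]
      linarith
    have h4 : ((a : ℝ) - u) / f * (lf / 2 + 1) ≤ C * (lf / 2 + 1) :=
      mul_le_mul_of_nonneg_right h3 (by linarith)
    linarith [h1, h2, h4]
  -- `C · log f ≤ C · log a`.
  have hClf : (C : ℝ) * lf ≤ C * la := mul_le_mul_of_nonneg_left hlfa (by linarith)
  -- Upper bound: `u (log f − log u) ≤ log L + 2k log 2 + (C+1)((log a)/2 + 1)`.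
  have hkey : (u : ℝ) * (lf - lu) ≤ X + 2 * k * Real.log 2 + ((C : ℝ) + 1) * (la / 2 + 1) := by
    linarith [hlog, hlast, hB1, hB2u, hB3, hClf, hlua]
  -- Lower bound: `u (log f − log u) ≥ (k/2) · 8 log 2`.
  have hprod : 4 * k * Real.log 2 ≤ (u : ℝ) * (lf - lu) := by
    have h1 : 0 ≤ ((u : ℝ) - k / 2) * (lf - lu) := mul_nonneg (by linarith) (by linarith)
    have h2 : 0 ≤ ((k : ℝ) / 2) * (lf - lu - 8 * Real.log 2) :=
      mul_nonneg (by positivity) (by linarith)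
    linarith [h1, h2]
  -- Exponentiate: compare logarithms of the two (positive) sides of the goal.
  have hgl : (0 : ℝ) < (16 : ℝ) ^ k := by positivity
  have hgr : (0 : ℝ) < (L : ℝ) ^ 2 * Real.exp (2 * ((C : ℝ) + 1)) * (a : ℝ) ^ (C + 1) :=
    mul_pos (mul_pos (pow_pos hLpos 2) (Real.exp_pos _)) (pow_pos hapos _)
  rw [← Real.log_le_log_iff hgl hgr,
    Real.log_mul (mul_pos (pow_pos hLpos 2) (Real.exp_pos _)).ne' (pow_pos hapos _).ne',
    Real.log_mul (pow_pos hLpos 2).ne' (Real.exp_pos _).ne', Real.log_exp, Real.log_pow,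
    Real.log_pow, Real.log_pow, show (16 : ℝ) = 2 ^ 4 by norm_num, Real.log_pow]
  push_cast
  linarith [hkey, hprod]

end Summit.ValiantsHypothesis.ValiantsHypothesis.Theorems.DivisionGap.PerMultiplesHard.SmallWindowArith

end
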